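import Mathlib
import Summits.Ventures.PercRepro.TriangleCapClosedFormArith

/-!
# PercRepro — the gain inequality (L2′) for the closed form `P_KK` (p3, gen 24)

`P = P_KK` is the prefix sum of the increment sequence `(1)(1,2)(1,2,3)…` of `TriangleCapClosedFormArith`.
The vertex-deletion proof of the graphic closed form `T(G) ≤ P_KK(e + 1 − n)` (`TriangleCapGraph`) deletes a
non-cut vertex `v` of degree `d` and bounds the triangles through `v` by `min (C(d,2)) ν`, `ν` the cyclomatic
number; it closes by **(L2′)** `min (C(d,2)) ν + P (ν − (d − 1)) ≤ P ν` for `1 ≤ d ≤ ν + 1` (`L2'`):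
* `C(d,2) ≤ ν`: the landed `L2`;
* `ν < C(d,2)`: the RUN IDENTITY `P (ν − (t + 1)) + ν = P ν` for `ν = tri t + i`, `1 ≤ i ≤ t + 1`
  (`P_sub_run_add`, from `P_closed` at `t − 1` and `t`: the last `t + 1` increments `i, …, 1, t, …, i + 1`
  sum to `tri t + i = ν`), then `d − 1 ≥ t + 1` (else `tri (d − 1) ≤ tri t < ν`) and `P` monotone
  (`P_mono`): `ν + P (ν − (d − 1)) ≤ ν + P (ν − (t + 1)) = P ν` (`L2_small`).
Axioms: standard.
-/

namespace PercRepro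

namespace TriangleCap

namespace KK

open Finset

/-- `P` is monotone. -/
theorem P_mono {a b : ℕ} (h : a ≤ b) : P a ≤ P b := by
  obtain ⟨ℓ, rfl⟩ := Nat.exists_eq_add_of_le h
  rw [P_add]
  exact Nat.le_add_right _ _

/-- `P 0 = 0`. -/
theorem P_zero : P 0 = 0 := by simp [P]

/-- `P 1 = 1`. -/
theorem P_one : P 1 = 1 := by decide

/-- **The run identity:** for `ν = tri t + i` with `1 ≤ i ≤ t + 1` (position `ν` lies in the run `R_{t+1}`),
the last `t + 1` increments sum to `ν`: `P (ν − (t + 1)) + ν = P ν`. -/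
theorem P_sub_run_add (t i : ℕ) (hi1 : 1 ≤ i) (hi : i ≤ t + 1) :
    P (tri t + i - (t + 1)) + (tri t + i) = P (tri t + i) := by
  rcases Nat.eq_zero_or_pos t with rfl | ht
  · have : i = 1 := by omega
    subst this
    simp [tri_zero, P_zero, P_one]
  · obtain ⟨t', rfl⟩ : ∃ t', t = t' + 1 := ⟨t - 1, by omega⟩
    have e1 : tri (t' + 1) + i - (t' + 1 + 1) = tri t' + (i - 1) := by
      rw [tri_succ]; omega
    rw [e1, P_closed t' (i - 1) (by omega), P_closed (t' + 1) i hi, tri_eq_choose,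
      Nat.sub_add_cancel hi1]
    have h1 : (t' + 1 + 2).choose 3 = (t' + 2).choose 2 + (t' + 2).choose 3 :=
      Nat.choose_succ_succ (t' + 2) 2
    have h2 : (i + 1).choose 2 = i + i.choose 2 := by
      rw [Nat.choose_succ_succ i 1, Nat.choose_one_right]
    rw [h1, h2]
    ring

/-- Every `ν ≥ 1` lies in a run: `ν = tri t + i` with `1 ≤ i ≤ t + 1`. -/
theorem exists_run (ν : ℕ) (hν : 1 ≤ ν) : ∃ t i, 1 ≤ i ∧ i ≤ t + 1 ∧ ν = tri t + i := by
  obtain ⟨n, rfl⟩ : ∃ n, ν = n + 1 := ⟨ν - 1, by omega⟩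
  obtain ⟨h1, h2, h3⟩ := st_inv (n + 1)
  have h4 := st_snd_pos n
  refine ⟨(st (n + 1)).1 - 1, (st (n + 1)).2, h4, by omega, ?_⟩
  rw [h3]

/-- The small case of the gain inequality: `ν + P (ν − (d − 1)) ≤ P ν` when `d − 1 ≤ ν < C(d,2)`. -/
theorem L2_small (d ν : ℕ) (hd : 1 ≤ d) (hν : d - 1 ≤ ν) (h : ν < d.choose 2) :
    ν + P (ν - (d - 1)) ≤ P ν := by
  rcases Nat.eq_zero_or_pos ν with rfl | hpos
  · simp
  · obtain ⟨t, i, hi1, hi, rfl⟩ := exists_run ν hpos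
    have e : d.choose 2 = tri (d - 1) := by rw [tri_eq_choose, Nat.sub_add_cancel hd]
    have ht : t + 1 ≤ d - 1 := by
      by_contra hc
      have := tri_mono (show d - 1 ≤ t by omega)
      omega
    have hm : P (tri t + i - (d - 1)) ≤ P (tri t + i - (t + 1)) := P_mono (by omega)
    have := P_sub_run_add t i hi1 hi
    omega

/-- **(L2′), the gain inequality:** for `1 ≤ d` and `d − 1 ≤ ν`,
`min (C(d,2)) ν + P (ν − (d − 1)) ≤ P ν`. -/
theorem L2' (d ν : ℕ) (hd : 1 ≤ d) (hν : d - 1 ≤ ν) :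
    min (d.choose 2) ν + P (ν - (d - 1)) ≤ P ν := by
  rcases le_or_gt (d.choose 2) ν with h | h
  · rw [min_eq_left h]
    exact L2 d ν hd h
  · rw [min_eq_right h.le]
    exact L2_small d ν hd hν h

end KK

end TriangleCap

end PercRepro
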